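import Mathlib.GroupTheory.Torsion
import Literature.IUT.HodgeArakelov.ThetaValueOrbits

/-!
# [IUTchII] Cor 1.12 (ii) / Cor 2.6 (ii) / Cor 2.8 (iii): the algebra of the zero-label splitting

Proof-only file (abc-iut cell, wave-3 discharge seat abc-iut-L6-d1; nodes **IUTchII:Cor2.8(iii)**,
**IUTchII:Cor2.9(iii)**, and the mechanism of **IUTchII:Cor1.12(ii)** / **IUTchII:Cor2.6(ii)**). No definitions.

S. Mochizuki, *Inter-universal Teichmüller theory II*, kurims manuscript (Dec. 2020): Cor. 1.12 (ii) p. 57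
("restriction to the subgroup `D ⊆ Π_Ÿ(Π)` determines … a commutative diagram
`{M^×_TM·∞θ(Π)}^ι → M^×_TM(Π)` …; the inverse images of the submodules of torsion elements via the … horizontal
arrows are given by `∞θ(Π)^ι` …; in particular, we obtain … splittings `M^{×μ}_TM(Π) × {∞θ(Π)^ι/M^μ_TM(Π)}` of
`{M^×_TM·∞θ(Π)}^ι/M^μ_TM(Π)`"), Cor. 2.6 (ii) p. 76 and Cor. 2.8 (iii) pp. 82–83 (the same at the zero-labelled
evaluation points: there "`θ^t` is the `μ_{2l}`-orbit of the identity", Cor. 2.6 (ii)). Claim key `Mochizuki2012`,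
status DISPUTED (D-0012); what is proved here is elementary abelian-group algebra and takes no side.

THE MECHANISM, abstractly (additive notation, as in the cell's cohomology interfaces). Let `f : A →+ B` be the
restriction map to the decomposition group of a zero-labelled evaluation point, `M ≤ A` the unit classes
`M^×_TM`, `S ⊆ A` the theta classes `∞θ^ι`. The two printed inputs are
 (1) `f` kills `S` modulo torsion — the theta VALUE at a zero-labelled point is a root of unity
     (Cor. 2.6 (ii): `θ^t = μ_{2l}·1`), hypothesis `hS`;
 (2) `f` is injective on `M` modulo torsion — the Kummer classes of units restrict faithfully to the
     decomposition group `D ≅ G_k` (Cor. 1.12 (i)(c): `M^×_TM(Π) ↪ lim_J H¹(J, (l·Δ_Θ)(Π))`), hypothesis `hM`.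
THEN: (a) `torsion_restrict_iff` — for `x = m + s ∈ M + S`, `f(x)` is torsion iff `m` is torsion, i.e. "the
inverse image of the torsion submodule is `∞θ^ι`" (up to `M^μ_TM`); (b) `zeroLabel_decomp_unique` — the
decomposition `x = m + s` is UNIQUE modulo torsion in each component, i.e. the printed SPLITTING
`(M + S)/M^μ ≅ M^{×μ} × (S/M^μ)` is well defined; (c) `zeroLabel_unit_component` — its unit component is
COMPUTED by `f`: `f(x) ≡ f(m)` modulo torsion, which is the sense in which "restriction … determines" the
splitting. These are exactly the non-degenerate clauses a faithful typing of Cor. 1.12 (ii) must carry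
(cf. the audit finding on `Cor112_ii_exists`, abc-iut-L6-t1, 2026-08-25), and they make the transport
form `ThetaValueOrbits.cor28iii_of_transport` of Cor. 2.8 (iii) concrete.
-/

namespace Literature.IUT.HodgeArakelov

namespace ThetaValueOrbits

universe u v

variable {A : Type u} {B : Type v} [AddCommGroup A] [AddCommGroup B]

/-- Differences of torsion elements are torsion (additive commutative groups). [folklore]-level helper,
cited to the source it serves. [claim: Mochizuki2012, status: disputed] -/
theorem isOfFinAddOrder_sub {x y : A} (hx : IsOfFinAddOrder x) (hy : IsOfFinAddOrder y) :
    IsOfFinAddOrder (x - y) := by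
  rw [sub_eq_add_neg]; exact hx.add hy.neg

/-- **IUTchII:Cor1.12(ii)** / **Cor2.6(ii)** (kurims p. 57 / p. 76), clause "the inverse images of the
submodules of torsion elements via the horizontal arrows are given by `∞θ^ι`": if the restriction `f` kills the
theta classes `S` modulo torsion and is injective on the unit classes `M` modulo torsion, then for
`x = m + s` (`m ∈ M`, `s ∈ S`) the restriction `f(x)` is torsion iff the unit part `m` is torsion.
[claim: Mochizuki2012, status: disputed] -/
theorem torsion_restrict_iff (f : A →+ B) {M : AddSubgroup A} {S : Set A}
    (hM : ∀ m ∈ M, IsOfFinAddOrder (f m) → IsOfFinAddOrder m) (hS : ∀ s ∈ S, IsOfFinAddOrder (f s))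
    {m s : A} (hm : m ∈ M) (hs : s ∈ S) : IsOfFinAddOrder (f (m + s)) ↔ IsOfFinAddOrder m := by
  rw [map_add]
  constructor
  · intro h
    have h1 : IsOfFinAddOrder (f m) := by
      have := isOfFinAddOrder_sub h (hS s hs)
      rwa [add_sub_cancel_right] at this
    exact hM m hm h1
  · intro h
    exact (f.isOfFinAddOrder h).add (hS s hs)

/-- **IUTchII:Cor1.12(ii)** / **Cor2.8(iii)** (kurims p. 57 / pp. 82–83), the SPLITTING is well defined: under
the same two inputs, a decomposition `x = m + s = m' + s'` with `m, m' ∈ M^×_TM` and `s, s' ∈ ∞θ^ι` is unique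
modulo torsion in each component — `m − m'` and `s − s'` are torsion — so
`(M^×_TM·∞θ^ι)/M^μ_TM ≅ M^{×μ}_TM × {∞θ^ι/M^μ_TM}`. [claim: Mochizuki2012, status: disputed] -/
theorem zeroLabel_decomp_unique (f : A →+ B) {M : AddSubgroup A} {S : Set A}
    (hM : ∀ m ∈ M, IsOfFinAddOrder (f m) → IsOfFinAddOrder m) (hS : ∀ s ∈ S, IsOfFinAddOrder (f s))
    {m m' s s' : A} (hm : m ∈ M) (hm' : m' ∈ M) (hs : s ∈ S) (hs' : s' ∈ S) (h : m + s = m' + s') :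
    IsOfFinAddOrder (m - m') ∧ IsOfFinAddOrder (s - s') := by
  have hms : m - m' = s' - s := by
    rw [sub_eq_sub_iff_add_eq_add, h, add_comm]
  have h1 : IsOfFinAddOrder (m - m') := by
    apply hM _ (M.sub_mem hm hm')
    rw [hms, map_sub]
    exact isOfFinAddOrder_sub (hS s' hs') (hS s hs)
  refine ⟨h1, ?_⟩
  have : s - s' = -(m - m') := by rw [hms, neg_sub]
  rw [this]
  exact h1.neg

/-- **IUTchII:Cor1.12(ii)** (kurims p. 57), "restriction … determines splittings": the unit component of
`x = m + s` is READ OFF from the restriction — `f(x) − f(m)` is torsion — so the splitting is the map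
`x ↦ (f(x) mod torsion, pulled back along f|_M ; x mod M)`. [claim: Mochizuki2012, status: disputed] -/
theorem zeroLabel_unit_component (f : A →+ B) {S : Set A} (hS : ∀ s ∈ S, IsOfFinAddOrder (f s))
    {m s : A} (hs : s ∈ S) : IsOfFinAddOrder (f (m + s) - f m) := by
  rw [map_add, add_sub_cancel_left]
  exact hS s hs

/-- **IUTchII:Cor2.6(ii)** / **Cor2.8(iii)** (kurims p. 76 / p. 82): at a ZERO-labelled evaluation point the
theta classes restrict into the `μ`-orbit of `0` (additively: into the torsion subgroup) — input (1) above in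
the vocabulary of `ThetaValueOrbits`: if the canonical `∞θ^t = μ·res_t(η)` at the zero label `t` is the
`μ`-orbit of `0` (Cor. 2.6 (ii): "equal to the `μ_{2l}`-orbit of the identity element"), then every class of
`∞θ^ι = μ·η` restricts to a torsion class. [claim: Mochizuki2012, status: disputed] -/
theorem restrict_isOfFinAddOrder_of_zero_label (res : A →+ B) {η : A} (h0 : res η ∈ muOrbit (0 : B))
    {s : A} (hs : s ∈ muOrbit η) : IsOfFinAddOrder (res s) := by
  obtain ⟨τ, hτ, rfl⟩ := hs
  obtain ⟨τ₀, hτ₀, h0'⟩ := h0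
  rw [zero_add] at h0'
  rw [map_add, h0']
  exact hτ₀.add (res.isOfFinAddOrder hτ)

/-- Packaging for consumers of `ThetaValueOrbits.Cor28iii_splitting` (Cor. 1.12 (ii) p. 57 / Cor. 2.8 (iii)
pp. 82–83): under inputs (1), (2) the relation "`x = m + s` with `m ∈ M^×_TM`, `s ∈ ∞θ^ι`" is the graph of a
well-defined map modulo torsion — two decompositions of the same `x` have equal components in
`(−)/torsion` (the form in which the quotient-level splitting is built by `Quot.lift`).
[claim: Mochizuki2012, status: disputed] -/
theorem zeroLabel_decomp_respects (f : A →+ B) {M : AddSubgroup A} {S : Set A}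
    (hM : ∀ m ∈ M, IsOfFinAddOrder (f m) → IsOfFinAddOrder m) (hS : ∀ s ∈ S, IsOfFinAddOrder (f s))
    {x m m' s s' : A} (hm : m ∈ M) (hm' : m' ∈ M) (hs : s ∈ S) (hs' : s' ∈ S) (hx : x = m + s)
    (hx' : x = m' + s') :
    (QuotientAddGroup.mk m : A ⧸ AddCommGroup.torsion A) = QuotientAddGroup.mk m' ∧
      (QuotientAddGroup.mk s : A ⧸ AddCommGroup.torsion A) = QuotientAddGroup.mk s' := by
  obtain ⟨h1, h2⟩ := zeroLabel_decomp_unique f hM hS hm hm' hs hs' (hx.symm.trans hx')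
  constructor
  · rw [QuotientAddGroup.eq_iff_sub_mem]
    exact (AddCommGroup.mem_torsion _).mpr h1
  · rw [QuotientAddGroup.eq_iff_sub_mem]
    exact (AddCommGroup.mem_torsion _).mpr h2

end ThetaValueOrbits

end Literature.IUT.HodgeArakelov
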